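import Literature.Analysis.FluidPDE.HeatDivFormTopImprovement
import Literature.Analysis.FluidPDE.NSBoundedSpatialHolderProofs
import HarnessLib

/-!
# Bounded vorticity and spatial Hölder slices of bounded local weak solutions, up to the top

Analysis/FluidPDE proofs file (theorems only; no definitions, no named facts). The accepted
`NSBoundedVorticityBounded_holds` and `NSBoundedSpatialHolder_holds` (Serrin 1962;
Robinson–Rodrigo–Sadowski 2016, Thm. 13.7 with `q = q' = ∞`, proof §13.3.2) conclude on the
centred sub-cylinders `Q*_r(z)`, `r < R`, of the cylinder `Q*_R(z) = ]t₀ - R², t₀ + R²[ × B(x₀, R)`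
carrying the hypotheses, i.e. away from both time ends. Parabolic interior regularity holds up to
the final time, and this file proves both statements **up to the top** `t₀ + R²`:

* `spin_bounded_top` — for an essentially bounded distributional Navier–Stokes solution on
  `Q*_R(z)` with `∇u ∈ L²`, the entries `Gᵢⱼ - Gⱼᵢ` of `∇u - ∇uᵀ` are essentially bounded on
  `]t₀ - r², t₀ + R²[ × B(x₀, r)` for every `0 < r < R` (RRS §13.3.2 Steps 1–2: the weak spin
  equation `NSSpinHeatEquation_holds` and three rounds `L² → L³ → L⁶ → L^∞` of the improvement
  up to the top, `HeatDivForm.heatDivForm_improvement_top`);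
* `holder_slices_top` — hence, for a.e. `t ∈ ]t₀ - r², t₀ + R²[`, the slice `u(t, ·)` agrees
  a.e. on `B(x₀, r)` with a `(C, α)`-Hölder field, `C`, `α > 0` independent of `t` (RRS §13.3.2
  Steps 3–4 in the tree's slice-wise elliptic form: `SerrinBoundedHolder.exists_holder_slice` fed
  with the discharged De Giorgi–Nash–Moser estimate `LaplaceDivFormInteriorHolder_holds`).

The proofs are those of the accepted `nsBoundedVorticityBounded_of` and
`nsBoundedSpatialHolder_of`, run on the product cylinders `]a, t₀ + R²[ × B(x₀, ρ)`.

## References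

* J. C. Robinson, J. L. Rodrigo, W. Sadowski, *The Three-Dimensional Navier–Stokes Equations.
  Classical theory*, CUP 2016, Thm. 13.7, proof §13.3.2 Steps 1–4, (13.11)–(13.19).
  [`RobinsonRodrigoSadowskiCUP2016`]
* J. Serrin, *On the interior regularity of weak solutions of the Navier–Stokes equations*,
  Arch. Rational Mech. Anal. 9 (1962) 187–195. [`Serrin1962`]
* D. Gilbarg, N. S. Trudinger, *Elliptic Partial Differential Equations of Second Order* (2001),
  Thm. 8.24. [`GilbargTrudinger2001`]
-/

noncomputable section

open MeasureTheory Set Function Filter Topology TopologicalSpace Metric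
open scoped NNReal ENNReal RealInnerProductSpace Laplacian

namespace Literature.Analysis.FluidPDE

namespace SerrinTop

/-- A product cylinder `]a, t₀ + R²[ × B(x₀, ρ)` with `t₀ - R² ≤ a`, `ρ ≤ R` lies in `Q*_R(z)`.
[folklore] -/
theorem prod_subset_parabolicCylinderCentered {z : ℝ × EuclideanSpace ℝ (Fin 3)} {R a ρ : ℝ}
    (ha : z.1 - R ^ 2 ≤ a) (hρ : ρ ≤ R) :
    Ioo a (z.1 + R ^ 2) ×ˢ ball z.2 ρ ⊆ parabolicCylinderCentered R z :=
  prod_mono (Ioo_subset_Ioo_left ha) (ball_subset_ball hρ)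

/-- **Bounded vorticity up to the top** (Robinson–Rodrigo–Sadowski 2016, Thm. 13.7, proof
§13.3.2 Steps 1–2 for `q = q' = ∞`). Let `(u, p)` solve the Navier–Stokes system (`ν = 1`, no
force) in the sense of distributions in `Q*_R(z)`, `|u| ≤ M` a.e., with weak spatial gradient
`G`, `∫∫ |G|² < ∞`. Then for every `0 < r < R` the entries `Gᵢⱼ - Gⱼᵢ` of the spin are essentially
bounded on `]t₀ - r², t₀ + R²[ × B(x₀, r)` — up to the top of `Q*_R(z)`. Three rounds
`(2,3)`, `(3,6)`, `(6,∞)` of `HeatDivForm.heatDivForm_improvement_top` on shrinking product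
cylinders sharing the top, fed by `NSSpinHeatEquation_holds` and `memLp_spinFlux`.
[cite: RobinsonRodrigoSadowskiCUP2016, Thm. 13.7, proof §13.3.2 Steps 1–2 with (13.17) (q = q' = ∞)] -/
theorem spin_bounded_top (u : ℝ → EuclideanSpace ℝ (Fin 3) → EuclideanSpace ℝ (Fin 3))
    (p : ℝ → EuclideanSpace ℝ (Fin 3) → ℝ) (z : ℝ × EuclideanSpace ℝ (Fin 3)) (R M : ℝ)
    (G : ℝ → EuclideanSpace ℝ (Fin 3) → EuclideanSpace ℝ (Fin 3) →L[ℝ] EuclideanSpace ℝ (Fin 3))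
    (hsol : IsDistributionalNSSolutionOn (parabolicCylinderCenteredOpens R z) 1 0 u p)
    (hbd : ∀ᵐ w ∂(volume.restrict (parabolicCylinderCentered R z)), ‖u w.1 w.2‖ ≤ M)
    (hG : HasWeakSpatialGradientOn (parabolicCylinderCenteredOpens R z) u G)
    (hG2 : ∫⁻ w in parabolicCylinderCentered R z, ENNReal.ofReal (frobeniusNormSq (G w.1 w.2)) < ∞)
    {r : ℝ} (hr : r ∈ Ioo 0 R) :
    ∃ K : ℝ, ∀ᵐ w ∂(volume.restrict (Ioo (z.1 - r ^ 2) (z.1 + R ^ 2) ×ˢ ball z.2 r)),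
      ∀ i j : Fin 3, |G w.1 w.2 (EuclideanSpace.single j (1 : ℝ)) i -
        G w.1 w.2 (EuclideanSpace.single i (1 : ℝ)) j| ≤ K := by
  obtain ⟨hr0, hrR⟩ := hr
  have hR0 : 0 < R := hr0.trans hrR
  set T : ℝ := z.1 + R ^ 2 with hT
  -- radii `r < ρ₂ < ρ₁ < R` and bottoms `t₀ - R² < a₁ < a₂ < t₀ - r²`
  set ρ₁ : ℝ := r + 2 * (R - r) / 3 with hρ₁
  set ρ₂ : ℝ := r + (R - r) / 3 with hρ₂
  have hrρ₂ : r < ρ₂ := by rw [hρ₂]; linarith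
  have hρ₂ρ₁ : ρ₂ < ρ₁ := by rw [hρ₁, hρ₂]; linarith
  have hρ₁R : ρ₁ < R := by rw [hρ₁]; linarith
  have hρ₂0 : 0 < ρ₂ := hr0.trans hrρ₂
  have hρ₁0 : 0 < ρ₁ := hρ₂0.trans hρ₂ρ₁
  have hsq : r ^ 2 < R ^ 2 := by nlinarith
  set a₀ : ℝ := z.1 - R ^ 2 with ha₀
  set a₃ : ℝ := z.1 - r ^ 2 with ha₃
  set a₁ : ℝ := a₀ + (a₃ - a₀) / 3 with ha₁
  set a₂ : ℝ := a₀ + 2 * (a₃ - a₀) / 3 with ha₂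
  have h01 : a₀ < a₁ := by rw [ha₁]; linarith
  have h12 : a₁ < a₂ := by rw [ha₁, ha₂]; linarith
  have h23 : a₂ < a₃ := by rw [ha₂]; linarith
  have h3T : a₃ < T := by rw [ha₃, hT]; nlinarith
  -- the product cylinders sharing the top
  have hsubC : ∀ {a ρ : ℝ}, a₀ ≤ a → ρ ≤ R →
      Ioo a T ×ˢ ball z.2 ρ ⊆ parabolicCylinderCentered R z := fun ha hρ =>
    prod_subset_parabolicCylinderCentered ha hρ
  -- the weak equation for tests on any of them
  have heq : ∀ (a ρ : ℝ), a₀ ≤ a → ρ ≤ R → ∀ (b c : Fin 3) (ψ : ℝ → EuclideanSpace ℝ (Fin 3) → ℝ),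
      IsSpaceTimeTestOn (⟨Ioo a T ×ˢ ball z.2 ρ, isOpen_Ioo.prod isOpen_ball⟩ :
        Opens (ℝ × EuclideanSpace ℝ (Fin 3))) ψ →
      ∫ q : ℝ × EuclideanSpace ℝ (Fin 3), spinEntry G b c q * (timeDeriv ψ q.1 q.2 + (Δ (ψ q.1)) q.2) =
        ∫ q : ℝ × EuclideanSpace ℝ (Fin 3), ⟪spinFlux u G b c q, gradient (ψ q.1) q.2⟫ := by
    intro a ρ ha hρ b c ψ hψ
    have hle : (⟨Ioo a T ×ˢ ball z.2 ρ, isOpen_Ioo.prod isOpen_ball⟩ :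
        Opens (ℝ × EuclideanSpace ℝ (Fin 3))) ≤ parabolicCylinderCenteredOpens R z :=
      fun q hq => hsubC ha hρ hq
    exact NSSpinHeatEquation_holds u p z R M G hsol hbd hG hG2 b c ψ (hψ.mono hle)
  -- measurability and boundedness of `u`, measurability of `G`, on the product cylinders
  have hdata : ∀ (a ρ : ℝ), a₀ ≤ a → ρ ≤ R →
      AEStronglyMeasurable (uncurry u) (volume.restrict (Ioo a T ×ˢ ball z.2 ρ)) ∧
      (∀ᵐ q ∂(volume.restrict (Ioo a T ×ˢ ball z.2 ρ)), ‖u q.1 q.2‖ ≤ M) ∧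
      AEStronglyMeasurable (uncurry G) (volume.restrict (Ioo a T ×ˢ ball z.2 ρ)) := by
    intro a ρ ha hρ
    have hsub := hsubC ha hρ
    exact ⟨(hsol.1.mono_set hsub).aestronglyMeasurable,
      ae_restrict_of_ae_restrict_of_subset hsub hbd,
      (hG.locallyIntegrableOn_grad.mono_set hsub).aestronglyMeasurable⟩
  -- one round of the improvement up to the top, for all entries at once
  have round : ∀ (m m' : ℝ≥0∞) (a a' ρ ρ' : ℝ), 1 < m → m ≤ m' → m⁻¹ < m'⁻¹ + 5⁻¹ →
      a₀ ≤ a → a < a' → a' < T → 0 < ρ' → ρ' < ρ → ρ ≤ R →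
      (∀ b c : Fin 3, MemLp (spinEntry G b c) m (volume.restrict (Ioo a T ×ˢ ball z.2 ρ))) →
      ∀ b c : Fin 3, MemLp (spinEntry G b c) m'
        (volume.restrict (Ioo a' T ×ˢ ball z.2 ρ')) := by
    intro m m' a a' ρ ρ' h1m hmm' hexp ha haa' ha'T hρ'0 hρ'ρ hρR hs b c
    obtain ⟨hum, huM, -⟩ := hdata a ρ ha hρR
    exact HeatDivForm.heatDivForm_improvement_top h1m hmm' hexp haa' ha'T hρ'0 hρ'ρ (hs b c)
      (memLp_spinFlux hum huM hs b c) (heq a ρ ha hρR b c)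
  -- start: `A ∈ L²(Q*_R)`
  have hstart : ∀ b c : Fin 3, MemLp (spinEntry G b c) 2
      (volume.restrict (Ioo a₀ T ×ˢ ball z.2 R)) := by
    intro b c
    have hQ : Ioo a₀ T ×ˢ ball z.2 R = parabolicCylinderCentered R z := rfl
    rw [hQ]
    have hGm : AEStronglyMeasurable (uncurry G) (volume.restrict (parabolicCylinderCentered R z)) :=
      hG.locallyIntegrableOn_grad.aestronglyMeasurable
    have hG2' := memLp_two_uncurry_of_lintegral_frobeniusNormSq hGm hG2
    refine hG2'.of_le_mul (aestronglyMeasurable_spinEntry hGm b c) (c := 2)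
      (Eventually.of_forall fun q => ?_)
    rw [Real.norm_eq_abs]
    exact abs_spinEntry_le G b c q
  obtain ⟨e23, e36, e6t⟩ := improvement_exponents
  -- three rounds
  have h3 : ∀ b c : Fin 3, MemLp (spinEntry G b c) 3
      (volume.restrict (Ioo a₁ T ×ˢ ball z.2 ρ₁)) :=
    round 2 3 a₀ a₁ R ρ₁ (by norm_num) (by norm_num) e23 le_rfl h01 (by linarith) hρ₁0 hρ₁R le_rfl
      hstart
  have h6 : ∀ b c : Fin 3, MemLp (spinEntry G b c) 6
      (volume.restrict (Ioo a₂ T ×ˢ ball z.2 ρ₂)) :=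
    round 3 6 a₁ a₂ ρ₁ ρ₂ (by norm_num) (by norm_num) e36 h01.le h12 (by linarith) hρ₂0 hρ₂ρ₁
      hρ₁R.le h3
  have htop : ∀ b c : Fin 3, MemLp (spinEntry G b c) ⊤
      (volume.restrict (Ioo a₃ T ×ˢ ball z.2 r)) :=
    round 6 ⊤ a₂ a₃ ρ₂ r (by norm_num) le_top e6t (h01.trans h12).le h23 h3T hr0 hrρ₂
      (hρ₂ρ₁.trans hρ₁R).le h6
  -- the essential suprema bound all entries
  set μ : Measure (ℝ × EuclideanSpace ℝ (Fin 3)) := volume.restrict (Ioo a₃ T ×ˢ ball z.2 r) with hμ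
  set N : Fin 3 → Fin 3 → ℝ := fun b c => (eLpNorm (spinEntry G b c) ⊤ μ).toReal with hN
  refine ⟨∑ b, ∑ c, N b c, ?_⟩
  have hNle : ∀ i j : Fin 3, N i j ≤ ∑ b, ∑ c, N b c := by
    intro i j
    have h0 : ∀ b c, 0 ≤ N b c := fun b c => ENNReal.toReal_nonneg
    calc N i j ≤ ∑ c, N i c :=
          Finset.single_le_sum (f := fun c => N i c) (fun c _ => h0 i c) (Finset.mem_univ j)
      _ ≤ ∑ b, ∑ c, N b c :=
          Finset.single_le_sum (f := fun b => ∑ c, N b c)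
            (fun b _ => Finset.sum_nonneg fun c _ => h0 b c) (Finset.mem_univ i)
  have hae : ∀ i j : Fin 3, ∀ᵐ q ∂μ, |spinEntry G i j q| ≤ N i j := by
    intro i j
    have hfin : eLpNorm (spinEntry G i j) ⊤ μ ≠ ⊤ := (htop i j).eLpNorm_ne_top
    filter_upwards [ae_le_eLpNormEssSup (f := spinEntry G i j) (μ := μ)] with q hq
    rw [hN]
    simp only [eLpNorm_exponent_top]
    rw [← Real.norm_eq_abs, ← toReal_enorm]
    exact (ENNReal.toReal_le_toReal enorm_ne_top (by simpa using hfin)).2 hq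
  have hall : ∀ᵐ q ∂μ, ∀ i j : Fin 3, |spinEntry G i j q| ≤ N i j :=
    ae_all_iff.2 fun i => ae_all_iff.2 fun j => hae i j
  filter_upwards [hall] with q hq i j
  have := hq i j
  rw [spinEntry_apply] at this
  exact this.trans (hNle i j)

/-- **Spatial Hölder continuity of the slices, up to the top** (Serrin 1962; Robinson–Rodrigo–
Sadowski 2016, Thm. 13.7 with `q = q' = ∞`, proof §13.3.2 Steps 1–4, slice-wise elliptic form).
Under the hypotheses of `spin_bounded_top`, for every `0 < r < R` there are `C`, `α > 0` such that
for a.e. `t ∈ ]t₀ - r², t₀ + R²[` the slice `u(t, ·)` agrees a.e. on `B(x₀, r)` with a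
`(C, α)`-Hölder field. Proof: the accepted assembly `nsBoundedSpatialHolder_of` on the product
cylinder `]t₀ - ρ², t₀ + R²[ × B(x₀, ρ)`, `ρ = (r + R)/2`: bounded spin (`spin_bounded_top`),
weak gradients, bounds, spin bounds, zero trace and finite energy slice-wise (Fubini), and
`SerrinBoundedHolder.exists_holder_slice` with `LaplaceDivFormInteriorHolder_holds`.
[cite: RobinsonRodrigoSadowskiCUP2016, Thm. 13.7 (q = q' = ∞) with its proof §13.3.2, Steps 1–4, (13.18)–(13.19)] -/
theorem holder_slices_top (u : ℝ → EuclideanSpace ℝ (Fin 3) → EuclideanSpace ℝ (Fin 3))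
    (p : ℝ → EuclideanSpace ℝ (Fin 3) → ℝ) (z : ℝ × EuclideanSpace ℝ (Fin 3)) (R M : ℝ)
    (G : ℝ → EuclideanSpace ℝ (Fin 3) → EuclideanSpace ℝ (Fin 3) →L[ℝ] EuclideanSpace ℝ (Fin 3))
    (hsol : IsDistributionalNSSolutionOn (parabolicCylinderCenteredOpens R z) 1 0 u p)
    (hbd : ∀ᵐ w ∂(volume.restrict (parabolicCylinderCentered R z)), ‖u w.1 w.2‖ ≤ M)
    (hG : HasWeakSpatialGradientOn (parabolicCylinderCenteredOpens R z) u G)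
    (hG2 : ∫⁻ w in parabolicCylinderCentered R z, ENNReal.ofReal (frobeniusNormSq (G w.1 w.2)) < ∞)
    {r : ℝ} (hr : r ∈ Ioo 0 R) :
    ∃ C α : ℝ≥0, 0 < α ∧
      ∀ᵐ t ∂(volume.restrict (Ioo (z.1 - r ^ 2) (z.1 + R ^ 2))),
        ∃ v : EuclideanSpace ℝ (Fin 3) → EuclideanSpace ℝ (Fin 3),
          HolderOnWith C α v (ball z.2 r) ∧ u t =ᵐ[volume.restrict (ball z.2 r)] v := by
  obtain ⟨hr0, hrR⟩ := hr
  set T : ℝ := z.1 + R ^ 2 with hT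
  -- an intermediate radius `r < ρ < R`
  set ρ : ℝ := (r + R) / 2 with hρ
  have hrρ : r < ρ := by rw [hρ]; linarith
  have hρR : ρ < R := by rw [hρ]; linarith
  have hρ0 : 0 < ρ := hr0.trans hrρ
  -- bounded spin up to the top on the `ρ`-cylinder, and the slice estimate
  obtain ⟨K, hK⟩ := spin_bounded_top u p z R M G hsol hbd hG hG2 ⟨hρ0, hρR⟩
  obtain ⟨C₀, α, hα, hslice⟩ :=
    SerrinBoundedHolder.exists_holder_slice LaplaceDivFormInteriorHolder_holds hr0 hrρ
  refine ⟨C₀ * (volume (ball z.2 ρ) ^ (2⁻¹ : ℝ) * ENNReal.ofReal |M| +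
    ENNReal.ofReal (3 * |K|)).toNNReal, α, hα, ?_⟩
  -- the product cylinder `I × B(x₀, ρ)` sharing the top
  set I : Set ℝ := Ioo (z.1 - ρ ^ 2) T with hI
  have hsub : I ×ˢ ball z.2 ρ ⊆ parabolicCylinderCentered R z :=
    prod_subset_parabolicCylinderCentered (by nlinarith) hρR.le
  have hle : (⟨I ×ˢ ((⟨ball z.2 ρ, isOpen_ball⟩ : Opens (EuclideanSpace ℝ (Fin 3))) :
        Set (EuclideanSpace ℝ (Fin 3))),
      isOpen_Ioo.prod (⟨ball z.2 ρ, isOpen_ball⟩ : Opens (EuclideanSpace ℝ (Fin 3))).isOpen⟩ :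
        Opens (ℝ × EuclideanSpace ℝ (Fin 3))) ≤ parabolicCylinderCenteredOpens R z :=
    fun q hq => hsub hq
  have hGρ : HasWeakSpatialGradientOn
      (⟨I ×ˢ ((⟨ball z.2 ρ, isOpen_ball⟩ : Opens (EuclideanSpace ℝ (Fin 3))) :
        Set (EuclideanSpace ℝ (Fin 3))),
        isOpen_Ioo.prod (⟨ball z.2 ρ, isOpen_ball⟩ : Opens (EuclideanSpace ℝ (Fin 3))).isOpen⟩ :
        Opens (ℝ × EuclideanSpace ℝ (Fin 3))) u G :=
    hG.mono hle
  -- (S1) slices have weak gradients on the ball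
  have hS1 : ∀ᵐ t ∂(volume.restrict I), FunctionSpaces.HasWeakFDerivOn
      (⟨ball z.2 ρ, isOpen_ball⟩ : Opens (EuclideanSpace ℝ (Fin 3))) volume (u t) (G t) :=
    hGρ.ae_hasWeakFDerivOn_slice
  -- (S2) the bound, (S3) the spin bound, (S5) the trace, slice-wise
  have hS2 : ∀ᵐ t ∂(volume.restrict I), ∀ᵐ x ∂(volume.restrict (ball z.2 ρ)), ‖u t x‖ ≤ M :=
    SerrinBoundedHolder.ae_ae_of_ae_restrict_prod (P := fun w => ‖u w.1 w.2‖ ≤ M)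
      (ae_restrict_of_ae_restrict_of_subset hsub hbd)
  have hS3 : ∀ᵐ t ∂(volume.restrict I), ∀ᵐ x ∂(volume.restrict (ball z.2 ρ)),
      ∀ i j : Fin 3, |G t x (EuclideanSpace.single j (1 : ℝ)) i -
        G t x (EuclideanSpace.single i (1 : ℝ)) j| ≤ K :=
    SerrinBoundedHolder.ae_ae_of_ae_restrict_prod
      (P := fun w => ∀ i j : Fin 3, |G w.1 w.2 (EuclideanSpace.single j (1 : ℝ)) i -
        G w.1 w.2 (EuclideanSpace.single i (1 : ℝ)) j| ≤ K) hK
  have hS5 : ∀ᵐ t ∂(volume.restrict I), ∀ᵐ x ∂(volume.restrict (ball z.2 ρ)),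
      ∑ j, G t x (EuclideanSpace.single j (1 : ℝ)) j = 0 := by
    have h := SerrinBoundedHolder.ae_trace_eq_zero hsol hG
    have h' : ∀ᵐ w ∂(volume.restrict (I ×ˢ ball z.2 ρ)),
        ∑ j, G w.1 w.2 (EuclideanSpace.single j (1 : ℝ)) j = 0 := by
      rw [ae_restrict_iff' (measurableSet_Ioo.prod measurableSet_ball)]
      filter_upwards [h] with w hw hwρ
      exact hw (hsub hwρ)
    exact SerrinBoundedHolder.ae_ae_of_ae_restrict_prod
      (P := fun w => ∑ j, G w.1 w.2 (EuclideanSpace.single j (1 : ℝ)) j = 0) h'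
  -- (S4) the energy, slice-wise
  have hGm : AEStronglyMeasurable (uncurry G) (volume.restrict (I ×ˢ ball z.2 ρ)) :=
    (hG.locallyIntegrableOn_grad.mono_set hsub).aestronglyMeasurable
  have hS4 : ∀ᵐ t ∂(volume.restrict I),
      ∫⁻ x in ball z.2 ρ, ‖G t x‖ₑ ^ (2 : ℝ) < ∞ := by
    refine SerrinBoundedHolder.ae_lintegral_lt_top_of_lintegral_prod
      (f := fun w => ‖G w.1 w.2‖ₑ ^ (2 : ℝ)) ?_ ?_
    · exact (hGm.aemeasurable.enorm.pow_const _)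
    · calc ∫⁻ w in I ×ˢ ball z.2 ρ, ‖G w.1 w.2‖ₑ ^ (2 : ℝ)
          ≤ ∫⁻ w in I ×ˢ ball z.2 ρ, ENNReal.ofReal (frobeniusNormSq (G w.1 w.2)) :=
            lintegral_mono fun w => SerrinBoundedHolder.enorm_rpow_two_le_ofReal_frobeniusNormSq _
        _ ≤ ∫⁻ w in parabolicCylinderCentered R z, ENNReal.ofReal (frobeniusNormSq (G w.1 w.2)) :=
            lintegral_mono_set hsub
        _ < ⊤ := hG2
  -- the conclusion on the smaller time window (same top)
  have hIr : Ioo (z.1 - r ^ 2) (z.1 + R ^ 2) ⊆ I := by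
    have : r ^ 2 < ρ ^ 2 := by nlinarith
    exact Ioo_subset_Ioo (by linarith) le_rfl
  refine ae_restrict_of_ae_restrict_of_subset hIr ?_
  filter_upwards [hS1, hS2, hS3, hS4, hS5] with t h1 h2 h3 h4 h5
  have hgm : AEStronglyMeasurable (G t) (volume.restrict (ball z.2 ρ)) :=
    h1.locallyIntegrableOn_deriv.aestronglyMeasurable
  have hg2 : MemLp (G t) 2 (volume.restrict (ball z.2 ρ)) := by
    refine ⟨hgm, ?_⟩
    rw [eLpNorm_eq_lintegral_rpow_enorm_toReal two_ne_zero ENNReal.ofNat_ne_top,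
      ENNReal.toReal_ofNat]
    refine ENNReal.rpow_lt_top_of_nonneg (by norm_num) ?_
    exact h4.ne
  obtain ⟨v', hv'H, hv'ae⟩ := hslice z.2 M K (u t) (G t) h1 h2 hg2 h3 h5
  exact ⟨v', hv'H, hv'ae⟩

end SerrinTop

end Literature.Analysis.FluidPDE

end
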